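import Summits.CriticalPhenomena.PercolationContinuityZ3.Theses.PercNonProliferation
import Summits.CriticalPhenomena.PercolationContinuityZ3.Theses.PercAnnulusCrossing
import Summits.CriticalPhenomena.PercolationContinuityZ3.Theorems.NonProliferation.Negative.AboveSix

/-!
# `NonProliferation` — negative side: the `M = 0` slice is the critical annulus crossing

Negative-side bookkeeping for the crux
`Summit.CriticalPhenomena.PercolationContinuityZ3.Theses.PercNonProliferation.NonProliferation`
(stmt-CriticalPhenomena-4444), from the standing disprover's work file
`Cruxes/NonProliferation/Disproof.lean` (cycle 1, §"The `M = 0` slice").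

* `repEvent_zero_eq_annulusCrossing`: the `M = 0` representative event `repEvent d 0 n` of
  `Negative/AboveSix.lean` IS the annulus-crossing event `{B(n) ↔ ∂ⁱⁿB(2n) in B(2n)}`
  (`Literature.Barriers.CriticalPhenomena.annulusCrossing d n`), i.e. the event of
  `PercAnnulusCrossing.CritAnnulusNonCrossing` (stmt-CriticalPhenomena-0846; `critAnnulusNonCrossing_iff`).
* `annulusCrossing_tendsto_one_of_not_nonProliferation`: if the crux FAILS, then
  `P_{p_c(ℤ³)}(B(n) ↔ ∂ⁱⁿB(2n) in B(2n)) → 1` — so any refutation of the crux refutes every RSW-type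
  (annulus-blocking) input on `ℤ³` first, in particular `CritAnnulusNonCrossing`
  (`not_critAnnulusNonCrossing_of_not_nonProliferation`). This is the disprover's first hurdle: the
  critical annulus-crossing probability of `ℤ³` is numerically a constant strictly below `1`.
-/

noncomputable section

namespace Summit.CriticalPhenomena.PercolationContinuityZ3.Theorems.NonProliferation.Negative

open MeasureTheory Filter Topology
open Literature.Probability.LatticeModels Literature.Probability.Percolation
open Literature.Barriers.CriticalPhenomena

/-- The `M = 0` representative event is the annulus-crossing event `{B(n) ↔ ∂ⁱⁿB(2n) in B(2n)}`. -/
theorem repEvent_zero_eq_annulusCrossing (d n : ℕ) : repEvent d 0 n = annulusCrossing d n := by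
  ext ω
  constructor
  · rintro ⟨x, hx, hconn, -⟩
    obtain ⟨y, hy, h⟩ := hconn 0
    exact ⟨x 0, hx 0, y, hy, h⟩
  · rintro ⟨x, hx, y, hy, h⟩
    exact ⟨fun _ => x, fun _ => hx, fun _ => ⟨y, hy, h⟩,
      fun i j hij => (hij (Fin.ext (by have := i.isLt; have := j.isLt; omega))).elim⟩

/-- `CritAnnulusNonCrossing` (stmt-CriticalPhenomena-0846, route `PercAnnulusCrossing`) is, verbatim,
a uniform bound `P_{p_c}(annulusCrossing 3 n) ≤ 1 - c` for `n ≥ 1`. -/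
theorem critAnnulusNonCrossing_iff :
    Summit.CriticalPhenomena.PercolationContinuityZ3.Theses.PercAnnulusCrossing.CritAnnulusNonCrossing ↔
      ∃ c : ℝ, 0 < c ∧ ∀ n : ℕ, 1 ≤ n →
        (bondPercolation (zdGraph 3) (criticalProbI 3)).real (annulusCrossing 3 n) ≤ 1 - c :=
  Iff.rfl

/-- **If the crux fails, the critical annulus of `ℤ³` is crossed with probability tending to one**
(the `M = 0` slice of `¬ NonProliferation`: for every `c > 0`, eventually
`P((repEvent 3 0 n)ᶜ) < c`). -/
theorem annulusCrossing_tendsto_one_of_not_nonProliferation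
    (h : ¬ Summit.CriticalPhenomena.PercolationContinuityZ3.Theses.PercNonProliferation.NonProliferation) :
    Tendsto (fun n : ℕ => (bondPercolation (zdGraph 3) (criticalProbI 3)).real (annulusCrossing 3 n))
      atTop (𝓝 1) := by
  rw [nonProliferation_iff] at h
  have hev : ∀ c : ℝ, 0 < c → ∀ᶠ n : ℕ in atTop,
      (bondPercolation (zdGraph 3) (criticalProbI 3)).real (repEvent 3 0 n)ᶜ < c := by
    intro c hc
    have : ¬ ∃ᶠ n : ℕ in atTop, c ≤ (bondPercolation (zdGraph 3) (criticalProbI 3)).real (repEvent 3 0 n)ᶜ :=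
      fun hf => h ⟨0, c, hc, hf⟩
    simpa [Filter.not_frequently, not_le] using this
  have h0 : Tendsto (fun n : ℕ => (bondPercolation (zdGraph 3) (criticalProbI 3)).real (repEvent 3 0 n)ᶜ)
      atTop (𝓝 0) :=
    tendsto_order.2 ⟨fun a ha => Filter.Eventually.of_forall fun n => lt_of_lt_of_le ha measureReal_nonneg,
      fun a ha => hev a ha⟩
  have h1 := (tendsto_const_nhds (x := (1 : ℝ))).sub h0
  rw [sub_zero] at h1
  refine h1.congr fun n => ?_
  rw [probReal_compl_eq_one_sub (measurableSet_repEvent 3 0 n), sub_sub_cancel,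
    repEvent_zero_eq_annulusCrossing]

/-- **A refutation of the crux would refute `CritAnnulusNonCrossing`** (stmt-CriticalPhenomena-0846):
the crux sits logically ABOVE the rank-3 crux of route `PercAnnulusCrossing` (which gives it with
`M = 0`), so the negatives of the two items are ordered the other way. -/
theorem not_critAnnulusNonCrossing_of_not_nonProliferation
    (h : ¬ Summit.CriticalPhenomena.PercolationContinuityZ3.Theses.PercNonProliferation.NonProliferation) :
    ¬ Summit.CriticalPhenomena.PercolationContinuityZ3.Theses.PercAnnulusCrossing.CritAnnulusNonCrossing := by
  rw [critAnnulusNonCrossing_iff]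
  rintro ⟨c, hc, hb⟩
  have ht := annulusCrossing_tendsto_one_of_not_nonProliferation h
  have hev : ∀ᶠ n : ℕ in atTop,
      (bondPercolation (zdGraph 3) (criticalProbI 3)).real (annulusCrossing 3 n) ≤ 1 - c :=
    Filter.eventually_atTop.2 ⟨1, hb⟩
  have := le_of_tendsto ht hev
  linarith

end Summit.CriticalPhenomena.PercolationContinuityZ3.Theorems.NonProliferation.Negative

end
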